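import Mathlib

/-!
# PF persistence — elementary calculus for the polar block (pub-rhpf, pf seat; helper for A8)

**HONEST FRAMING. Long-odds MECHANISM SEARCH; no RH claims.** Pure calculus, RH-free: explicit antiderivatives
and the definite integrals on `[0, L]` of `(L−y)/L · cosh(y/2)`, `sin(ky) cosh(y/2)`, `cos(ky) cosh(y/2)` and
`y cos(ky) cosh(y/2)` when `kL ∈ 2πℤ`, plus `sin(2πm/L · L) = 0`, `cos(2πm/L · L) = 1` (valid also at `L = 0`).
They are consumed by `PfPersistencePolarRankOne.lean`, which proves that the polar block
`polarBlock` of `Theorems/PfPersistenceAdmissibleClass.lean` is a scalar multiple of a rank-one matrix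
(the identification hypothesis A8 of the cell's adjudication log). Labels: **PROVED** = kernel-checked; no DATA.
-/

set_option linter.dupNamespace false  -- the mandated namespace repeats `RiemannHypothesis`

noncomputable section

open Real intervalIntegral

namespace Summit.RiemannHypothesis.RiemannHypothesis.Theorems.PfPersistence.PolarRankOne

/-! ## Antiderivatives (elementary calculus) -/

/-- `D(k) = 1/4 + k²`, the common denominator. [folklore] -/
def Dk (k : ℝ) : ℝ := 1 / 4 + k ^ 2

/-- PROVED: `D(k) > 0`. [folklore] -/
theorem Dk_pos (k : ℝ) : 0 < Dk k := by unfold Dk; positivity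

/-- antiderivative of `sin(ky) cosh(y/2)`. [folklore] -/
def Fb (k y : ℝ) : ℝ :=
  Real.sin (k * y) * Real.sinh (y / 2) / (2 * Dk k) - k * (Real.cos (k * y) * Real.cosh (y / 2)) / Dk k

/-- antiderivative of `cos(ky) cosh(y/2)`. [folklore] -/
def Fc (k y : ℝ) : ℝ :=
  Real.cos (k * y) * Real.sinh (y / 2) / (2 * Dk k) + k * (Real.sin (k * y) * Real.cosh (y / 2)) / Dk k

/-- antiderivative of `cos(ky) sinh(y/2)`. [folklore] -/
def Fe (k y : ℝ) : ℝ :=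
  Real.cos (k * y) * Real.cosh (y / 2) / (2 * Dk k) + k * (Real.sin (k * y) * Real.sinh (y / 2)) / Dk k

/-- antiderivative of `y cos(ky) cosh(y/2)`. [folklore] -/
def Fd (k y : ℝ) : ℝ :=
  y * Fc k y - Fe k y / (2 * Dk k) - k * Fb k y / Dk k

/-- antiderivative of `(L − y)/L · cosh(y/2)`. [folklore] -/
def Fa (L y : ℝ) : ℝ :=
  2 * ((L - y) / L * Real.sinh (y / 2)) + 4 / L * Real.cosh (y / 2)

/-- PROVED: derivative of `y ↦ k y`. [folklore] -/
theorem hasDerivAt_ky (k y : ℝ) : HasDerivAt (fun y : ℝ => k * y) k y := by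
  simpa using (hasDerivAt_id y).const_mul k

/-- PROVED: derivative of `y ↦ y/2`. [folklore] -/
theorem hasDerivAt_half (y : ℝ) : HasDerivAt (fun y : ℝ => y / 2) (1 / 2) y :=
  (hasDerivAt_id y).div_const 2

/-- PROVED: `Fb' = sin(ky) cosh(y/2)`. [folklore] -/
theorem hasDerivAt_Fb (k y : ℝ) :
    HasDerivAt (Fb k) (Real.sin (k * y) * Real.cosh (y / 2)) y := by
  have hD := (Dk_pos k).ne'
  have h : HasDerivAt (Fb k)
      ((Real.cos (k * y) * k * Real.sinh (y / 2) + Real.sin (k * y) * (Real.cosh (y / 2) * (1 / 2))) /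
          (2 * Dk k) -
        k * (-Real.sin (k * y) * k * Real.cosh (y / 2) + Real.cos (k * y) * (Real.sinh (y / 2) * (1 / 2))) /
          Dk k) y :=
    (((hasDerivAt_ky k y).sin.mul (hasDerivAt_half y).sinh).div_const (2 * Dk k)).sub
      ((((hasDerivAt_ky k y).cos.mul (hasDerivAt_half y).cosh).const_mul k).div_const (Dk k))
  refine h.congr_deriv ?_
  unfold Dk at hD ⊢
  field_simp
  ring

/-- PROVED: `Fc' = cos(ky) cosh(y/2)`. [folklore] -/
theorem hasDerivAt_Fc (k y : ℝ) :
    HasDerivAt (Fc k) (Real.cos (k * y) * Real.cosh (y / 2)) y := by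
  have hD := (Dk_pos k).ne'
  have h : HasDerivAt (Fc k)
      ((-Real.sin (k * y) * k * Real.sinh (y / 2) + Real.cos (k * y) * (Real.cosh (y / 2) * (1 / 2))) /
          (2 * Dk k) +
        k * (Real.cos (k * y) * k * Real.cosh (y / 2) + Real.sin (k * y) * (Real.sinh (y / 2) * (1 / 2))) /
          Dk k) y :=
    (((hasDerivAt_ky k y).cos.mul (hasDerivAt_half y).sinh).div_const (2 * Dk k)).add
      ((((hasDerivAt_ky k y).sin.mul (hasDerivAt_half y).cosh).const_mul k).div_const (Dk k))
  refine h.congr_deriv ?_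
  unfold Dk at hD ⊢
  field_simp
  ring

/-- PROVED: `Fe' = cos(ky) sinh(y/2)`. [folklore] -/
theorem hasDerivAt_Fe (k y : ℝ) :
    HasDerivAt (Fe k) (Real.cos (k * y) * Real.sinh (y / 2)) y := by
  have hD := (Dk_pos k).ne'
  have h : HasDerivAt (Fe k)
      ((-Real.sin (k * y) * k * Real.cosh (y / 2) + Real.cos (k * y) * (Real.sinh (y / 2) * (1 / 2))) /
          (2 * Dk k) +
        k * (Real.cos (k * y) * k * Real.sinh (y / 2) + Real.sin (k * y) * (Real.cosh (y / 2) * (1 / 2))) /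
          Dk k) y :=
    (((hasDerivAt_ky k y).cos.mul (hasDerivAt_half y).cosh).div_const (2 * Dk k)).add
      ((((hasDerivAt_ky k y).sin.mul (hasDerivAt_half y).sinh).const_mul k).div_const (Dk k))
  refine h.congr_deriv ?_
  unfold Dk at hD ⊢
  field_simp
  ring

/-- PROVED: `Fd' = y cos(ky) cosh(y/2)`. [folklore] -/
theorem hasDerivAt_Fd (k y : ℝ) :
    HasDerivAt (Fd k) (y * (Real.cos (k * y) * Real.cosh (y / 2))) y := by
  have hD := (Dk_pos k).ne'
  have h : HasDerivAt (Fd k)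
      (1 * Fc k y + y * (Real.cos (k * y) * Real.cosh (y / 2)) -
        Real.cos (k * y) * Real.sinh (y / 2) / (2 * Dk k) -
        k * (Real.sin (k * y) * Real.cosh (y / 2)) / Dk k) y :=
    (((hasDerivAt_id y).mul (hasDerivAt_Fc k y)).sub ((hasDerivAt_Fe k y).div_const (2 * Dk k))).sub
      (((hasDerivAt_Fb k y).const_mul k).div_const (Dk k))
  refine h.congr_deriv ?_
  simp only [Fc]
  unfold Dk at hD ⊢
  field_simp
  ring

/-- PROVED: `Fa' = (L − y)/L · cosh(y/2)`. [folklore] -/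
theorem hasDerivAt_Fa (L y : ℝ) :
    HasDerivAt (Fa L) ((L - y) / L * Real.cosh (y / 2)) y := by
  have h1 : HasDerivAt (fun y : ℝ => (L - y) / L) ((0 - 1) / L) y :=
    ((hasDerivAt_const y L).sub (hasDerivAt_id y)).div_const L
  have h : HasDerivAt (Fa L)
      (2 * ((0 - 1) / L * Real.sinh (y / 2) + (L - y) / L * (Real.cosh (y / 2) * (1 / 2))) +
        4 / L * (Real.sinh (y / 2) * (1 / 2))) y :=
    ((h1.mul (hasDerivAt_half y).sinh).const_mul 2).add (((hasDerivAt_half y).cosh).const_mul (4 / L))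
  refine h.congr_deriv ?_
  ring

/-! ## Definite integrals on `[0, L]` -/

/-- PROVED: `∫₀ᴸ (L−y)/L cosh(y/2) dy = 4 (cosh(L/2) − 1)/L`. [folklore] -/
theorem integral_Fa (L : ℝ) :
    ∫ y in (0:ℝ)..L, (L - y) / L * Real.cosh (y / 2) = 4 * (Real.cosh (L / 2) - 1) / L := by
  rw [integral_eq_sub_of_hasDerivAt (fun y _ => hasDerivAt_Fa L y)
    ((by fun_prop : Continuous fun y : ℝ => (L - y) / L * Real.cosh (y / 2)).intervalIntegrable _ _)]
  simp [Fa]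
  ring

/-- PROVED: `∫₀ᴸ sin(ky) cosh(y/2) dy = −k (cosh(L/2) − 1)/D(k)` when `kL ∈ 2πℤ`. [folklore] -/
theorem integral_sin_cosh (k L : ℝ) (hs : Real.sin (k * L) = 0) (hc : Real.cos (k * L) = 1) :
    ∫ y in (0:ℝ)..L, Real.sin (k * y) * Real.cosh (y / 2) = -(k * (Real.cosh (L / 2) - 1)) / Dk k := by
  rw [integral_eq_sub_of_hasDerivAt (fun y _ => hasDerivAt_Fb k y)
    ((by fun_prop : Continuous fun y : ℝ => Real.sin (k * y) * Real.cosh (y / 2)).intervalIntegrable _ _)]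
  simp [Fb, hs, hc]
  ring

/-- PROVED: `∫₀ᴸ cos(ky) cosh(y/2) dy = sinh(L/2)/(2 D(k))` when `kL ∈ 2πℤ`. [folklore] -/
theorem integral_cos_cosh (k L : ℝ) (hs : Real.sin (k * L) = 0) (hc : Real.cos (k * L) = 1) :
    ∫ y in (0:ℝ)..L, Real.cos (k * y) * Real.cosh (y / 2) = Real.sinh (L / 2) / (2 * Dk k) := by
  rw [integral_eq_sub_of_hasDerivAt (fun y _ => hasDerivAt_Fc k y)
    ((by fun_prop : Continuous fun y : ℝ => Real.cos (k * y) * Real.cosh (y / 2)).intervalIntegrable _ _)]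
  simp [Fc, hs, hc]

/-- PROVED: `∫₀ᴸ y cos(ky) cosh(y/2) dy = L sinh(L/2)/(2D) − (cosh(L/2) − 1)(1/4 − k²)/D²` when `kL ∈ 2πℤ`.
[folklore] -/
theorem integral_mul_cos_cosh (k L : ℝ) (hs : Real.sin (k * L) = 0) (hc : Real.cos (k * L) = 1) :
    ∫ y in (0:ℝ)..L, y * (Real.cos (k * y) * Real.cosh (y / 2)) =
      L * Real.sinh (L / 2) / (2 * Dk k) - (Real.cosh (L / 2) - 1) * (1 / 4 - k ^ 2) / (Dk k) ^ 2 := by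
  have hD := (Dk_pos k).ne'
  rw [integral_eq_sub_of_hasDerivAt (fun y _ => hasDerivAt_Fd k y)
    ((by fun_prop : Continuous fun y : ℝ => y * (Real.cos (k * y) * Real.cosh (y / 2))).intervalIntegrable _ _)]
  simp [Fd, Fc, Fe, Fb, hs, hc]
  field_simp
  ring

/-! ## `k L ∈ 2πℕ` for `k = 2π m / L` (also at `L = 0`, where `k = 0`) -/

/-- PROVED: `sin(2πm/L · L) = 0`. [folklore] -/
theorem sin_kL (m : ℕ) (L : ℝ) : Real.sin (2 * π * m / L * L) = 0 := by
  rcases eq_or_ne L 0 with h | h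
  · simp [h]
  · rw [div_mul_cancel₀ _ h]
    have := Real.sin_nat_mul_pi (2 * m)
    push_cast at this
    rw [show (2 : ℝ) * π * m = 2 * m * π by ring]
    exact this

/-- PROVED: `cos(2πm/L · L) = 1`. [folklore] -/
theorem cos_kL (m : ℕ) (L : ℝ) : Real.cos (2 * π * m / L * L) = 1 := by
  rcases eq_or_ne L 0 with h | h
  · simp [h]
  · rw [div_mul_cancel₀ _ h]
    have := Real.cos_nat_mul_two_pi m
    rw [show (2 : ℝ) * π * m = m * (2 * π) by ring]
    exact this

end Summit.RiemannHypothesis.RiemannHypothesis.Theorems.PfPersistence.PolarRankOne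

end
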